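import Summits.QuantumAdvantage.QuantumAdvantage.Theorems.CubicForrelationNearExactIsExactTwelveWeight768Hyperplane

/-!
# Crux `CubicForrelation.NearExactIsExact` (stmt-QuantumAdvantage-14043) — a weight-`768` cubic support on 12 bits: the `L¹` mass of its
  character sums is `≥ 6144` (moment bookkeeping continued from `…TwelveWeight768Hyperplane.lean`)

Certificate seat `b2b-cforr-cert` (gen 15).  HONEST FRAMING: a coding-theory lemma (standard axioms) for the TYPE-O branch below `59/64` at
`n = 12` — it feeds the step "the rank-4 quadratic `c|_A` violates (H4) on the hyperplane `A`" (`fl1_flat_l1` bounds the `L¹` mass by `8192`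
under (H3)/(H4), while the restriction has mass `≥ 2(6144 − 1536) > 8192`).  NOT summit progress.

`to15_weight768_l1`: `Σ_y |F(y)| ≥ 6144` for `F(y) = Σ_{c(x)=1}(−1)^{x·y}`, `c` cubic with `768` ones.  From the moments of the hyperplane file:
`N₁ + 9N₃ = 48` (Parseval), `p = 192N₃ − 256` with `p = #{a : E ⊕ a = E}` a power of two (`sw_card_xorClosed`), so `N₃ ∈ {2, 4}` and
`Σ|F| = 256N₁ + 768N₃ = 12288 − 1536N₃ ≥ 6144`.

References: Kasami–Tokura (1970); MacWilliams–Sloane (1977) Ch. 15; O'Donnell (2014) §3.3.  Everything below is proved from Mathlib and the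
tree; axioms are the standard three.
-/

set_option linter.dupNamespace false -- D-0017: single-problem summit ⇒ `QuantumAdvantage.QuantumAdvantage` by design

noncomputable section

namespace Summit.QuantumAdvantage.QuantumAdvantage.Theorems.CubicForrelation.NearExactIsExact

open Finset
open Literature.Computability.QuantumComplexity
open Literature.Computability.QuantumComplexity.BuzetChailloux (bxor zeroVec bxor_bxor_cancel_left bxor_zeroVec zeroVec_bxor bxor_comm
  bxor_self twist_zeroVec_right)
open Literature.Computability.QuantumComplexity.DerivativeWalsh (W twist_bxor_left)
open Summit.QuantumAdvantage.QuantumAdvantage.Theorems.SignedCubicForrelationNotPrBPP (knf_isDegLeFun_ip)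

/-! ### The `L¹` mass -/


/-- **`L¹` mass of the character sums of a weight-768 cubic support**: `Σ_y |Σ_{c(x)=1} (−1)^{x·y}| ≥ 6144`.  (With `N₃ = #{F = ±768}`,
`N₁ = #{F = ±256}`: Parseval `N₁ + 9N₃ = 48`, moments `p = 192N₃ − 256` for the number `p` of periods of `E`, a power of two; hence
`N₃ ∈ {2, 4}` and `Σ|F| = 12288 − 1536N₃`.) [this work] -/
theorem to15_weight768_l1 (c : (Fin (6 + 6) → Bool) → Bool) (hc : IsDegLeFun 3 c)
    (h768 : #(univ.filter fun x => c x = true) = 768) :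
    (6144 : ℝ) ≤ ∑ y, |∑ x ∈ univ.filter (fun x => c x = true), twist x y| := by
  classical
  set S := univ.filter (fun x : Fin (6 + 6) → Bool => c x = true) with hSdef
  have hmemS : ∀ x, x ∈ S ↔ c x = true := fun x => by simp [hSdef]
  set F : (Fin (6 + 6) → Bool) → ℝ := fun z => ∑ x ∈ S, twist x z with hFdef
  /- (A) the five values of `F` -/
  have hFval : ∀ z, ∃ m : ℤ, (m = 3 ∨ m = 1 ∨ m = 0 ∨ m = -1 ∨ m = -3) ∧ F z = 256 * (m : ℝ) :=
    fun z => to15_char_values c hc h768 z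
  /- (C) Parseval `Σ F² = 2¹²·768` -/
  set A : (Fin (6 + 6) → Bool) → ℝ := fun x => if x ∈ S then 1 else 0 with hAdef
  have hWA : ∀ z, W A z = F z := by
    intro z
    unfold W
    have e : ∀ x, A x * twist x z = if x ∈ S then twist x z else 0 := fun x => by
      simp only [A]; split_ifs <;> simp
    rw [sum_congr rfl fun x _ => e x, ← sum_filter, filter_mem_eq_inter, univ_inter]
  have hPars : ∑ z, F z ^ 2 = 4096 * 768 := by
    have h := fp_parseval_pm A S (fun x hx => Or.inl (by simp [A, hx])) (fun x hx => by simp [A, hx])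
    rw [sum_congr rfl fun z _ => by rw [hWA z], h768] at h
    rw [h]; norm_num
  /- (B) `I(a) = #(E ∩ (E ⊕ a)) ∈ {0, 256, 768}` -/
  set I : (Fin (6 + 6) → Bool) → ℕ := fun a => #(S.filter fun x => bxor x a ∈ S) with hIdef
  have hIle : ∀ a, I a ≤ 768 := fun a => (card_filter_le _ _).trans h768.le
  have hI0 : I zeroVec = 768 := by
    simp only [I]
    rw [filter_true_of_mem (fun x hx => by rw [bxor_zeroVec]; exact hx), h768]
  have hind : ∀ x, signOf (c x) = 1 - 2 * (if x ∈ S then (1 : ℝ) else 0) := by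
    intro x
    by_cases hx : x ∈ S
    · rw [if_pos hx]; have hc' := (hmemS x).1 hx; unfold signOf; rw [if_pos hc']; norm_num
    · rw [if_neg hx]
      have hc' : ¬ c x = true := fun h => hx ((hmemS x).2 h)
      unfold signOf; rw [if_neg hc']; norm_num
  have hIval : ∀ a, I a = 0 ∨ I a = 256 ∨ I a = 768 := by
    intro a
    have hD : IsDegLeFun 2 (fun x => c x ^^ c (bxor x a)) := stub_derivDegree (6 + 6) 2 c a hc
    obtain ⟨s, hs⟩ := stub_quadWalshPlateau (6 + 6) _ hD
    -- the Walsh value at `0` of the derivative: `1024 + 4 I(a)`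
    have hW0 : W (fun x => signOf (c x ^^ c (bxor x a))) zeroVec = 1024 + 4 * (I a : ℝ) := by
      unfold W
      simp_rw [twist_zeroVec_right, mul_one, signOf_xor]
      rw [sum_congr rfl fun x _ => by rw [hind x, hind (bxor x a)]]
      have e1 : ∀ x : Fin (6 + 6) → Bool, (1 - 2 * (if x ∈ S then (1 : ℝ) else 0)) * (1 - 2 * (if bxor x a ∈ S then (1 : ℝ) else 0)) =
          1 - 2 * (if x ∈ S then (1 : ℝ) else 0) - 2 * (if bxor x a ∈ S then (1 : ℝ) else 0) +
            4 * (if (x ∈ S ∧ bxor x a ∈ S) then (1 : ℝ) else 0) := by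
        intro x; by_cases h1 : x ∈ S <;> by_cases h2 : bxor x a ∈ S <;> norm_num [h1, h2]
      rw [sum_congr rfl fun x _ => e1 x, sum_add_distrib, sum_sub_distrib, sum_sub_distrib, sum_const, card_univ, Fintype.card_fun,
        Fintype.card_bool, Fintype.card_fin, ← mul_sum, ← mul_sum, ← mul_sum, sum_boole, sum_boole, sum_boole]
      have c1 : #(univ.filter fun x : Fin (6 + 6) → Bool => x ∈ S) = 768 := by
        rw [show (univ.filter fun x : Fin (6 + 6) → Bool => x ∈ S) = S by ext x; simp, h768]
      have c2 : #(univ.filter fun x : Fin (6 + 6) → Bool => bxor x a ∈ S) = 768 := by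
        rw [← h768]
        refine card_nbij' (fun x => bxor x a) (fun x => bxor x a) (fun x hx => ?_) (fun x hx => ?_)
          (fun x _ => by show bxor (bxor x a) a = x; rw [iw_bxor_assoc, bxor_self, bxor_zeroVec])
          (fun x _ => by show bxor (bxor x a) a = x; rw [iw_bxor_assoc, bxor_self, bxor_zeroVec])
        · rw [mem_coe, mem_filter] at hx; exact hx.2
        · rw [mem_coe] at hx; rw [mem_coe, mem_filter, iw_bxor_assoc, bxor_self, bxor_zeroVec]; exact ⟨mem_univ _, hx⟩
      have c3 : #(univ.filter fun x : Fin (6 + 6) → Bool => x ∈ S ∧ bxor x a ∈ S) = I a := by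
        simp only [I]; congr 1; ext x; simp
      rw [c1, c2, c3]
      norm_num
    rcases hs zeroVec with h0 | hsq
    · exfalso
      rw [hW0] at h0
      have : (0 : ℝ) ≤ I a := by positivity
      linarith
    · rw [hW0] at hsq
      have h4 : (4 : ℝ) ^ s = ((2 : ℝ) ^ s) ^ 2 := by
        rw [show (4 : ℝ) = 2 ^ 2 by norm_num, ← pow_mul, mul_comm, pow_mul]
      rw [h4] at hsq
      have hpos : (0 : ℝ) ≤ 1024 + 4 * (I a : ℝ) := by positivity
      have h2s : 1024 + 4 * (I a : ℝ) = (2 : ℝ) ^ s := (pow_left_inj₀ hpos (by positivity) (by norm_num : (2 : ℕ) ≠ 0)).1 hsq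
      have hIle' : (I a : ℝ) ≤ 768 := by exact_mod_cast hIle a
      have hs_le : s ≤ 12 := by
        by_contra h
        push Not at h
        have : (2 : ℝ) ^ 13 ≤ 2 ^ s := pow_le_pow_right₀ (by norm_num) h
        norm_num at this; linarith
      have hs_ge : 10 ≤ s := by
        by_contra h
        push Not at h
        have : (2 : ℝ) ^ s ≤ 2 ^ 9 := pow_le_pow_right₀ (by norm_num) (by omega)
        have : (0 : ℝ) ≤ I a := by positivity
        norm_num at *; linarith
      interval_cases s
      · left
        have h' : (I a : ℝ) = 0 := by rw [show (2 : ℝ) ^ 10 = 1024 by norm_num] at h2s; linarith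
        exact_mod_cast h'
      · right; left
        have h' : (I a : ℝ) = 256 := by rw [show (2 : ℝ) ^ 11 = 2048 by norm_num] at h2s; linarith
        exact_mod_cast h'
      · right; right
        have h' : (I a : ℝ) = 768 := by rw [show (2 : ℝ) ^ 12 = 4096 by norm_num] at h2s; linarith
        exact_mod_cast h'
  /- (D) the fourth moment `Σ_z F⁴ = 2¹² · #Q`, `#Q = Σ_a J(a)²`, `J = I`, `Σ_a J(a) = 768²` -/
  set P2 := S ×ˢ S with hP2
  set J : (Fin (6 + 6) → Bool) → ℕ := fun a => #(P2.filter fun q => bxor q.1 q.2 = a) with hJdef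
  have hJI : ∀ a, J a = I a := by
    intro a
    simp only [J, I]
    refine card_nbij' (fun q => q.1) (fun x => (x, bxor x a)) (fun q hq => ?_) (fun x hx => ?_) (fun q hq => ?_) (fun x _ => rfl)
    · rw [mem_coe, mem_filter, hP2, mem_product] at hq
      rw [mem_coe, mem_filter]
      refine ⟨hq.1.1, ?_⟩
      rw [← hq.2, bxor_bxor_cancel_left]; exact hq.1.2
    · rw [mem_coe, mem_filter] at hx
      rw [mem_coe, mem_filter, hP2, mem_product]
      exact ⟨⟨hx.1, hx.2⟩, bxor_bxor_cancel_left _ _⟩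
    · rw [mem_coe, mem_filter] at hq
      obtain ⟨-, h⟩ := hq
      show (q.1, bxor q.1 a) = q
      rw [← h, bxor_bxor_cancel_left]
  have hJsum : ∑ a, (J a : ℝ) = 768 * 768 := by
    have h := card_eq_sum_card_fiberwise (s := P2) (t := (univ : Finset (Fin (6 + 6) → Bool))) (f := fun q => bxor q.1 q.2)
      (fun q _ => mem_univ _)
    rw [hP2, card_product, h768] at h
    have h' : ((768 * 768 : ℕ) : ℝ) = ∑ a, (J a : ℝ) := by rw [h]; push_cast; rfl
    rw [← h']; norm_num
  set Q := (P2 ×ˢ P2).filter (fun q => bxor q.1.1 q.1.2 = bxor q.2.1 q.2.2) with hQdef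
  have hQ : (#Q : ℝ) = ∑ a, (J a : ℝ) ^ 2 := by
    have h := card_eq_sum_card_fiberwise (s := Q) (t := (univ : Finset (Fin (6 + 6) → Bool))) (f := fun q => bxor q.1.1 q.1.2)
      (fun q _ => mem_univ _)
    rw [h]; push_cast
    refine sum_congr rfl fun a _ => ?_
    have e : Q.filter (fun q => bxor q.1.1 q.1.2 = a) = (P2.filter fun q => bxor q.1 q.2 = a) ×ˢ (P2.filter fun q => bxor q.1 q.2 = a) := by
      ext q
      simp only [hQdef, mem_filter, mem_product]
      constructor
      · rintro ⟨⟨hq, heq⟩, ha⟩; exact ⟨⟨hq.1, ha⟩, hq.2, by rw [← heq, ha]⟩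
      · rintro ⟨⟨h1, ha1⟩, h2, ha2⟩; exact ⟨⟨⟨h1, h2⟩, by rw [ha1, ha2]⟩, ha1⟩
    rw [e, card_product]; push_cast; ring
  have hF2 : ∀ z, F z ^ 2 = ∑ q ∈ P2, twist (bxor q.1 q.2) z := by
    intro z
    rw [sq, hFdef, sum_mul_sum, hP2, sum_product]
    exact sum_congr rfl fun x _ => sum_congr rfl fun y _ => (twist_bxor_left x y z).symm
  have hF4 : ∑ z, F z ^ 4 = 4096 * (#Q : ℝ) := by
    have e1 : ∀ z, F z ^ 4 = ∑ q ∈ P2 ×ˢ P2, twist (bxor (bxor q.1.1 q.1.2) (bxor q.2.1 q.2.2)) z := by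
      intro z
      rw [show F z ^ 4 = F z ^ 2 * F z ^ 2 by ring, hF2 z, sum_mul_sum, Finset.sum_product (s := P2) (t := P2)]
      exact sum_congr rfl fun q _ => sum_congr rfl fun q' _ => (twist_bxor_left _ _ z).symm
    rw [sum_congr rfl fun z _ => e1 z, sum_comm]
    rw [sum_congr rfl fun q _ => Simon.sum_twist (bxor (bxor q.1.1 q.1.2) (bxor q.2.1 q.2.2))]
    rw [← sum_filter, sum_const, nsmul_eq_mul]
    have e2 : (P2 ×ˢ P2).filter (fun q => bxor (bxor q.1.1 q.1.2) (bxor q.2.1 q.2.2) = fun _ => false) = Q := by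
      rw [hQdef]
      refine filter_congr fun q _ => ?_
      constructor
      · intro h
        have := congrArg (bxor (bxor q.1.1 q.1.2)) h
        rw [bxor_bxor_cancel_left] at this
        rw [this]; exact (bxor_zeroVec _).symm
      · intro h; rw [h]; exact bxor_self _
    rw [e2, show (2 : ℝ) ^ (6 + 6) = 4096 by norm_num, mul_comm]
  /- (E) counting: `p = #{I = 768} ≥ 1`, `N₃ = #{F = ±768}`; the moments give `p + 384 = 192 N₃ + 128` -/
  -- pointwise polynomial identities on the finite value sets
  have hIsq : ∀ a, ((I a : ℝ)) ^ 2 = 256 * (I a : ℝ) + 393216 * (if I a = 768 then (1 : ℝ) else 0) := by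
    intro a; rcases hIval a with h | h | h <;> simp [h] <;> norm_num
  have hF4pt : ∀ z, F z ^ 4 = 65536 * F z ^ 2 + 309237645312 * (if (F z = 768 ∨ F z = -768) then (1 : ℝ) else 0) := by
    intro z
    obtain ⟨m, hm, hFz⟩ := hFval z
    rw [hFz]
    rcases hm with rfl | rfl | rfl | rfl | rfl <;> norm_num
  have hIsum : ∑ a, (I a : ℝ) = 589824 := by
    have e : ∀ a, (I a : ℝ) = (J a : ℝ) := fun a => by rw [hJI a]
    rw [sum_congr rfl fun a _ => e a, hJsum]; norm_num
  have hI2sum : ∑ a, (I a : ℝ) ^ 2 = 256 * 589824 + 393216 * (#(univ.filter fun a : Fin (6 + 6) → Bool => I a = 768) : ℝ) := by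
    rw [sum_congr rfl fun a _ => hIsq a, sum_add_distrib, ← mul_sum, ← mul_sum, hIsum, sum_boole]
  have hF4sum : ∑ z, F z ^ 4 = 65536 * (4096 * 768) +
      309237645312 * (#(univ.filter fun z : Fin (6 + 6) → Bool => (F z = 768 ∨ F z = -768)) : ℝ) := by
    rw [sum_congr rfl fun z _ => hF4pt z, sum_add_distrib, ← mul_sum, ← mul_sum, hPars, sum_boole]
  have hQJ : (#Q : ℝ) = ∑ a, (I a : ℝ) ^ 2 := by rw [hQ]; exact sum_congr rfl fun a _ => by rw [hJI a]
  -- `p ≥ 1`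
  have hp1 : 1 ≤ #(univ.filter fun a : Fin (6 + 6) → Bool => I a = 768) :=
    card_pos.2 ⟨zeroVec, mem_filter.2 ⟨mem_univ _, hI0⟩⟩
  -- the period group `P₀ = {a : I a = 768}` is xor-closed, so `p` is a power of two
  set P₀ := univ.filter (fun a : Fin (6 + 6) → Bool => I a = 768) with hP₀
  have hP₀mem : ∀ a, a ∈ P₀ ↔ ∀ x ∈ S, bxor x a ∈ S := by
    intro a
    rw [hP₀, mem_filter]
    simp only [mem_univ, true_and, I]
    constructor
    · intro h x hx
      have hsub : S.filter (fun x => bxor x a ∈ S) = S := eq_of_subset_of_card_le (filter_subset _ _) (by rw [h, h768])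
      have hx' : x ∈ S.filter (fun x => bxor x a ∈ S) := by rw [hsub]; exact hx
      exact (mem_filter.1 hx').2
    · intro h
      rw [filter_true_of_mem fun x hx => h x hx, h768]
  have hP₀0 : zeroVec ∈ P₀ := (hP₀mem _).2 fun x hx => by rw [bxor_zeroVec]; exact hx
  have hP₀add : ∀ a ∈ P₀, ∀ b ∈ P₀, bxor a b ∈ P₀ := by
    intro a ha b hb
    rw [hP₀mem] at ha hb ⊢
    intro x hx
    rw [← iw_bxor_assoc]
    exact hb _ (ha x hx)
  obtain ⟨j, hj, hpj⟩ := sw_card_xorClosed P₀ hP₀0 hP₀add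
  -- Parseval in counts: `65536 N₁ + 589824 N₃ = 3145728`
  have hF2pt : ∀ z, F z ^ 2 = 65536 * (if (F z = 256 ∨ F z = -256) then (1 : ℝ) else 0) +
      589824 * (if (F z = 768 ∨ F z = -768) then (1 : ℝ) else 0) := by
    intro z
    obtain ⟨m, hm, hFz⟩ := hFval z
    rw [hFz]
    rcases hm with rfl | rfl | rfl | rfl | rfl <;> norm_num
  have hFabs : ∀ z, |F z| = 256 * (if (F z = 256 ∨ F z = -256) then (1 : ℝ) else 0) +
      768 * (if (F z = 768 ∨ F z = -768) then (1 : ℝ) else 0) := by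
    intro z
    obtain ⟨m, hm, hFz⟩ := hFval z
    rw [hFz]
    rcases hm with rfl | rfl | rfl | rfl | rfl <;> norm_num [abs_of_nonneg, abs_of_nonpos]
  have hParsN : 65536 * (#(univ.filter fun z : Fin (6 + 6) → Bool => (F z = 256 ∨ F z = -256)) : ℝ) +
      589824 * (#(univ.filter fun z : Fin (6 + 6) → Bool => (F z = 768 ∨ F z = -768)) : ℝ) = 4096 * 768 := by
    rw [← hPars, sum_congr rfl fun z _ => hF2pt z, sum_add_distrib, ← mul_sum, ← mul_sum, sum_boole, sum_boole]
  have hL1 : ∑ y, |F y| = 256 * (#(univ.filter fun z : Fin (6 + 6) → Bool => (F z = 256 ∨ F z = -256)) : ℝ) +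
      768 * (#(univ.filter fun z : Fin (6 + 6) → Bool => (F z = 768 ∨ F z = -768)) : ℝ) := by
    rw [sum_congr rfl fun z _ => hFabs z, sum_add_distrib, ← mul_sum, ← mul_sum, sum_boole, sum_boole]
  -- the moment identity in counts: `p = 192 N₃ − 256`
  have key := hF4
  rw [hF4sum, hQJ, hI2sum] at key
  set N3 := #(univ.filter fun z : Fin (6 + 6) → Bool => (F z = 768 ∨ F z = -768)) with hN3
  set N1 := #(univ.filter fun z : Fin (6 + 6) → Bool => (F z = 256 ∨ F z = -256)) with hN1
  have hpR : (#P₀ : ℝ) = 192 * (N3 : ℝ) - 256 := by linarith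
  have hpZ : (#P₀ : ℤ) = 192 * (N3 : ℤ) - 256 := by exact_mod_cast hpR
  have hpdvd : #P₀ ∣ 4096 := by
    rw [hpj, show (4096 : ℕ) = 2 ^ 12 by norm_num]; exact pow_dvd_pow 2 hj
  -- `N₃ ≤ 5` from Parseval, and `p ∣ 4096` excludes `N₃ ∈ {3, 5}`
  have hN3le : N3 ≤ 5 := by
    have h1 : (589824 : ℝ) * N3 ≤ 4096 * 768 := by
      have : (0 : ℝ) ≤ N1 := by positivity
      linarith
    have h3 : (N3 : ℝ) < 6 := by linarith
    have h4 : N3 < 6 := by exact_mod_cast h3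
    omega
  have hN3val : N3 = 2 ∨ N3 = 4 := by
    interval_cases N3
    · exfalso; omega
    · exfalso; omega
    · exact Or.inl rfl
    · exfalso
      have hp : #P₀ = 320 := by omega
      rw [hp] at hpdvd; norm_num at hpdvd
    · exact Or.inr rfl
    · exfalso
      have hp : #P₀ = 704 := by omega
      rw [hp] at hpdvd; norm_num at hpdvd
  -- conclude
  show (6144 : ℝ) ≤ ∑ y, |F y|
  rw [hL1]
  have hN1eq : (N1 : ℝ) = 48 - 9 * N3 := by linarith
  rw [hN1eq]
  rcases hN3val with h | h <;> rw [h] <;> norm_num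

end Summit.QuantumAdvantage.QuantumAdvantage.Theorems.CubicForrelation.NearExactIsExact

end
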